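import Summits.RiemannHypothesis.RiemannHypothesis.Theorems.IntegerScrewCensusFastPairs

/-!
# Route `IntegerScrew` — fast kernel arithmetic for manifest-certificate checks (4b): the error law of the trig rows

The two NUMERIC steps of the row invariant of `IntegerScrewCensusFastRows.buildRows`, isolated from the list bookkeeping:
* `Uk Wmax τ j = (32·j·Wmax/τ + 14)/2^52` — the per-atom error unit (`Wmax` = largest log-enclosure width, scale `2^48`);
* `base_err` — a base node (from `primeVal_err`): `‖ẑ − e^{iθ}‖ ≤ U`;
* `composite_err` — a composite node `m = p·q'` with `p` a base node (`ε_p ≤ U`) and `ε_{q'} ≤ (2d − 1)·U`, `d ≤ 7`,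
  `U ≤ 1/26`: the rounded product (`step_err`) satisfies `ε_m ≤ (2(d+1) − 1)·U` — the linear depth law.
What remains for `manifestCert_of_fastCheck` is list plumbing (induction over `buildRows`) and the pair-sum/DD layer
(HOME/sos/CENSUS-KERNEL-IMPORT-engA.md §4).  Pure arithmetic; RH-free and ζ-free; nothing here bears on the truth of RH.
-/

set_option linter.dupNamespace false
set_option autoImplicit false

namespace Summit.RiemannHypothesis.RiemannHypothesis.Theorems.IntegerScrew.Manifest.Fast

open Finset

/-- The per-atom error unit `U_k = (32·j·Wmax/τ + 14)/2^52`. -/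
noncomputable def Uk (Wmax τ j : ℕ) : ℝ := (32 * (j : ℝ) * Wmax / τ + 14) / SCL

/-- The unit complex number `e^{iθ}` as a pair. -/
theorem exp_mul_I_eq (θ : ℝ) : Complex.exp ((θ : ℂ) * Complex.I) = ⟨Real.cos θ, Real.sin θ⟩ := by
  apply Complex.ext
  · simp [Complex.exp_ofReal_mul_I_re]
  · simp [Complex.exp_ofReal_mul_I_im]

/-- From componentwise errors `e` (ulps) to the complex norm: `‖ẑ − e^{iθ}‖ ≤ 2e/2^52`. -/
theorem zOf_err_of_components {X Y : ℕ} {θ e : ℝ} (hC : |(oval X : ℝ) - SCL * Real.cos θ| ≤ e)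
    (hS : |(oval Y : ℝ) - SCL * Real.sin θ| ≤ e) :
    ‖zOf X Y - Complex.exp ((θ : ℂ) * Complex.I)‖ ≤ 2 * e / SCL := by
  have hS0 : (0 : ℝ) < SCL := by norm_num [SCL]
  rw [exp_mul_I_eq]
  have e1 : zOf X Y - (⟨Real.cos θ, Real.sin θ⟩ : ℂ) =
      ⟨((oval X : ℝ) - SCL * Real.cos θ) / SCL, ((oval Y : ℝ) - SCL * Real.sin θ) / SCL⟩ := by
    apply Complex.ext
    · simp [zOf]; field_simp
    · simp [zOf]; field_simp
  rw [e1]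
  refine (norm_mk_le _ _).trans ?_
  rw [abs_div, abs_div, abs_of_pos hS0, ← add_div]
  refine div_le_div_of_nonneg_right ?_ hS0.le
  linarith

/-- **Base nodes.**  With the log enclosure `[L, L+W]/2^48 ∋ log m`, `W ≤ Wmax`, the range flag and the size check,
`‖ẑ − e^{i t log m}‖ ≤ U_k`. -/
theorem base_err {L W Wmax j τ m : ℕ} (hτ : 0 < τ) (hlo : (L : ℝ) ≤ 2 ^ 48 * Real.log m)
    (hhi : (2 : ℝ) ^ 48 * Real.log m ≤ (L : ℝ) + W) (hW : W ≤ Wmax)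
    (hE : (16 * j * Wmax : ℝ) / τ + 5 ≤ 2 ^ 60) (hok : (primeVal tcList L j τ).1 = true) :
    ‖zOf (primeVal tcList L j τ).2.1 (primeVal tcList L j τ).2.2 -
        Complex.exp ((((j : ℝ) / τ * Real.log m : ℝ) : ℂ) * Complex.I)‖ ≤ Uk Wmax τ j := by
  have hτr : (0 : ℝ) < τ := by exact_mod_cast hτ
  have hj : (0 : ℝ) ≤ j := Nat.cast_nonneg j
  have hWr : (W : ℝ) ≤ Wmax := by exact_mod_cast hW
  have hmono : (16 * j * W : ℝ) / τ ≤ 16 * j * Wmax / τ := by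
    refine div_le_div_of_nonneg_right ?_ hτr.le
    exact mul_le_mul_of_nonneg_left hWr (by positivity)
  have hE' : (16 * j * W : ℝ) / τ + 5 ≤ 2 ^ 60 := by linarith
  obtain ⟨hC, hSn⟩ := primeVal_err (x := Real.log m) hτ hlo hhi hE' hok
  refine (zOf_err_of_components hC hSn).trans ?_
  unfold Uk
  have hS0 : (0 : ℝ) < SCL := by norm_num [SCL]
  refine div_le_div_of_nonneg_right ?_ hS0.le
  have h2 : (32 : ℝ) * j * Wmax / τ = 2 * (16 * j * Wmax / τ) := by ring
  rw [h2]
  linarith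

/-- **Composite nodes** (the linear depth law).  If `ε_p ≤ U` (base factor), `ε_q ≤ (2d − 1)U` with `1 ≤ d ≤ 7` and
`14/2^52 ≤ U ≤ 1/26`, then the rounded product is within `(2(d+1) − 1)·U` of `z_p z_q`. -/
theorem composite_err {X1 X2 Y1 Y2 : ℕ} {z w : ℂ} {U : ℝ} {d : ℕ}
    (hp : ‖zOf X1 X2 - z‖ ≤ U) (hq : ‖zOf Y1 Y2 - w‖ ≤ (2 * d - 1 : ℝ) * U) (hz : ‖z‖ = 1) (hw : ‖w‖ = 1)
    (hd1 : 1 ≤ d) (hd : d ≤ 7) (hUlo : (14 : ℝ) / SCL ≤ U) (hUhi : U ≤ 1 / 26) :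
    ‖zOf (cmulRe X1 X2 Y1 Y2) (cmulIm X1 X2 Y1 Y2) - z * w‖ ≤ (2 * (d + 1 : ℕ) - 1 : ℝ) * U := by
  have hS0 : (0 : ℝ) < SCL := by norm_num [SCL]
  have hU0 : 0 ≤ U := le_trans (norm_nonneg _) hp
  have hdr : (1 : ℝ) ≤ d := by exact_mod_cast hd1
  have hdr' : (d : ℝ) ≤ 7 := by exact_mod_cast hd
  have he1 : U ≤ 1 := by linarith
  have he2 : (2 * d - 1 : ℝ) * U ≤ 1 := by nlinarith
  have hstep := step_err hp hq hz hw he1 he2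
  have hprod : U * ((2 * d - 1 : ℝ) * U) ≤ U / 2 := by
    have h13 : (2 * d - 1 : ℝ) ≤ 13 := by linarith
    have h1 : U * ((2 * d - 1 : ℝ) * U) ≤ U * (13 * U) :=
      mul_le_mul_of_nonneg_left (mul_le_mul_of_nonneg_right h13 hU0) hU0
    have h2 : U * (13 * U) ≤ U / 2 := by
      have := mul_le_mul_of_nonneg_left hUhi (by positivity : (0 : ℝ) ≤ 13 * U)
      linarith
    linarith
  have hround : (2 : ℝ) / SCL ≤ U / 2 := by
    have : (2 : ℝ) / SCL * 7 = 14 / SCL := by ring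
    nlinarith [hS0]
  push_cast
  nlinarith

/-- The true values multiply: `e^{i t log(p q')} = e^{i t log p} · e^{i t log q'}` (`p, q' ≥ 1`). -/
theorem exp_log_mul {p q : ℕ} (hp : 0 < p) (hq : 0 < q) (t : ℝ) :
    Complex.exp ((((t * Real.log (p * q : ℕ) : ℝ)) : ℂ) * Complex.I) =
      Complex.exp ((((t * Real.log p : ℝ)) : ℂ) * Complex.I) * Complex.exp ((((t * Real.log q : ℝ)) : ℂ) * Complex.I) := by
  rw [← Complex.exp_add]
  congr 1
  have hp' : (p : ℝ) ≠ 0 := by exact_mod_cast hp.ne'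
  have hq' : (q : ℝ) ≠ 0 := by exact_mod_cast hq.ne'
  push_cast
  rw [Real.log_mul hp' hq']
  push_cast
  ring

/-- Unit norm of the true values. -/
theorem norm_exp_real_mul_I (θ : ℝ) : ‖Complex.exp ((θ : ℂ) * Complex.I)‖ = 1 :=
  Complex.norm_exp_ofReal_mul_I θ

end Summit.RiemannHypothesis.RiemannHypothesis.Theorems.IntegerScrew.Manifest.Fast
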